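import Summits.QuantumFields.YangMills.Theorems.FluctuationComparisonRegPrIntLS2BetaRelativeLadderStep
import Summits.QuantumFields.YangMills.Theorems.FluctuationComparisonRegPrIntLS2BetaTreeCombBondStep
import HarnessLib

/-!
# S2β · Q11b-lattice — THE INTRA-BLOCK TOP LADDER: WHEN THE TREE-COMB BONDS OF A BLOCK CARRY NO CHORD, EVERY INTRA-BLOCK BOND'S CHORD IS AT MOST
# `(Σ_{ν<e} |(y − c)_ν|)·ρ ≤ e·((L−1)∕2)·ρ` (any torus in standing range, any `GaugeGroup`; the lattice half of (TOP-LAD)'s intra-block part (B))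

Cell `ym3-torus` (rung R3 = continuum `SU(2)` YM₃ on T³ at fixed lattice data — NOT d = 4, NOT infinite volume, NOT a mass gap, NOT Clay).  Width seat `ym3-torus-px5` (gen 23);
crux `stmt-QuantumFields-20520`, LINE g18-1 S2β.  By kernel (✓p830018 ∘ ✓p829725 ∘ ✓p830137∕✓p830683): GAP♯∘ ⟸ {h3, (D-stage)×2, LIFT-LADDER}, LIFT-LADDER = (TOP-LAD) ∧ (LIFT-LAD) ∧
(SCT-c), `c = c₁ + c₂ + c₃`; the `c₃` (TOP∕FACE) row = intra-block ladder (B) + face deviation + face mean (px20 g23 17:51:05Z (ii), px17 g22 17:58:06Z).  THIS FILE is (B) at the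
LATTICE level, abstractly in the two configurations: HYPOTHESES — `W = U` on every TREE-COMB bond of the block `B` (a bond `⟨x, μ⟩` with `x, x+e_μ ∈ B` and `(x − emb B)_ν = 0` for all
`ν < μ` — exactly the bonds on which (4b) ✓`stageChord_treeComb_top` gives chord `1` at the top stage on the fibre), and every plaquette with source in `B` has relative size `≤ ρ`;
CONCLUSION — every bond `⟨y, e⟩` with `y, y+e ∈ B` has `dist1 (U⟨y,e⟩⁻¹·W⟨y,e⟩) ≤ (Σ_{ν<e} |(y − emb B)_ν|)·ρ ≤ e·((L−1)∕2)·ρ`.  PROOF = induction on `n = Σ_{ν<e} |(y − emb B)_ν|`: at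
`n = 0` the bond is itself tree-comb; otherwise take the LOWEST direction `μ < e` with `(y − emb B)_μ ≠ 0` and move `y` one step towards the comb along `μ`: the unit square so swept
has BOTH rails tree-comb (lower coordinates vanish, and `+e` does not touch them) so Q11a′ ✓p830038 `dist1_farRung_rel_le` ∕ `dist1_nearRung_rel_le` (according to the sign of the
coordinate) bounds the chord by the previous chord `+ ρ +` a rail-pair term that is IDENTICALLY `1`.  Coordinates via lit ✓`transl`∕`rel` (`B10Eq27TorusAxialLog`) and
✓`blockOf_eq_of_near_emb`; no words, no walks.  `--kind proof --supports stmt-QuantumFields-20520 --as helper`, count-neutral, DEFINITION-FREE (0 `def`, 0 `instance`, 0 `notation`,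
0 `sorry`, default heartbeats); generic `P : Params` (standing range `j + 1 ≤ m + K`), ANY `GaugeGroup G`.

WHAT IS PROVED (sorry-free).
* §1 coordinates (over lit ✓`AveragingReflection.two_mul_L_le_sitesPerDir`): `blockOf_transl_emb` (a translate of the centre by `|v|_∞ ≤ (L−1)∕2` lies in the block), `rel_emb_transl` (its relative position IS `v`),
  `coord_sub_e`∕`coord_add_e`, `exists_min_dir` (the lowest direction below `e` with a nonzero coordinate).
* §2 ★★★`dist1_chord_transl_le` — the coordinate form: for `v` with `|v|_∞ ≤ (L−1)∕2`, `v_e + 1 ≤ (L−1)∕2` and `Σ_{ν<e}|v_ν| = n`: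
  **`dist1 (U⟨emb B + v, e⟩⁻¹·W⟨emb B + v, e⟩) ≤ n·ρ`**.
* §3 ★★★`dist1_chord_le_of_intraBlock` — the block form: `blockOf y = B`, `blockOf (y+e) = B` ⟹ **`dist1 (U⟨y,e⟩⁻¹·W⟨y,e⟩) ≤ (Σ_{ν<e} |(y − emb B)_ν|)·ρ`**, and
  ★`dist1_chord_le_of_intraBlock'` : **`≤ (e·((L−1)∕2))·ρ`**.

HONEST SCOPE.  Lattice∕group bookkeeping; nothing of Bałaban's analysis is asserted or proved; the identification «plain chord = stage chord up to the common gauge» and the tree-comb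
agreement from (4b) + the fibre, the face-crossing bonds (deviation + mean, TOP-JENSEN ✓p830761), the square∕`Σ_B`∕READ′ aggregation of (TOP-LAD′) are NOT here; (TOP-LAD)∕(LIFT-LAD)∕
(SCT-c)∕(ST′)∕(ST), LOC's discharge, «MULT♭-ax»∕«CRIT-ax», (D-stage), h3, GAP♯∘ (`stub_uniformFibreGapOrbit`, registry 3732b7df UNTOUCHED, 0∕5), S2β, the five registered stubs, 20520,
19936, 19200, `YM3TorusSU2` NOT proved; no summit statement is proved by a helper; rung R3 — NOT d = 4, NOT infinite volume, NOT a mass gap, NOT Clay; the Yang–Mills mass gap is NOT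
proved.

References: T. Bałaban, CMP **122** (1989) 355–392 [Balaban1989LargeFieldII] (p.382: in the tree gauge a bond variable is a product of plaquette variables along the comb);
CMP **98** (1985) 17–51 [Balaban1985Averaging] ((19) p.21, p.24 — axial gauge in blocks, the comb contours); CMP **102** (1985) 277–309 [Balaban1985RegularSpaces] ((1.19) p.79).
-/

set_option autoImplicit false

namespace Summit.QuantumFields.YangMills.Theorems.FluctuationComparisonRegPrIntLS2BetaTopLadderIntraBlock

open Literature.MathematicalPhysics.QuantumFieldTheory.Balaban1983to89
open Literature.MathematicalPhysics.QuantumFieldTheory.Balaban1983to89.T4Continuum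
open Literature.MathematicalPhysics.QuantumFieldTheory.Balaban1983to89.BlockAveraging
open B10Eq27TorusAxialLog (transl rel transl_apply transl_add_e transl_sub_e transl_rel rel_apply rel_shift_of_le rel_transl_of_mem)
open B7Prop1Explicit (e e_apply)
open Summit.QuantumFields.YangMills.Theorems.FluctuationComparisonRegPrIntLS2BetaRelativeStokes (dist1_mul_inv_eq_rel)
open Summit.QuantumFields.YangMills.Theorems.FluctuationComparisonRegPrIntLS2BetaRelativeLadderHolonomy (dist1_square_rel_le)
open Summit.QuantumFields.YangMills.Theorems.FluctuationComparisonRegPrIntLS2BetaRelativeLadderStep (dist1_farRung_rel_le dist1_nearRung_rel_le)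

variable {P : Params} {j : ℕ} {G : Type*} [GaugeGroup G]

/-! ## §1 Coordinates in a block -/

/-- A translate of the block centre by a vector of sup-norm `≤ (L−1)∕2` lies in the block. [cite: Balaban1987RG1, (0.3) p.252] -/
theorem blockOf_transl_emb (hj : j + 1 ≤ P.m + P.K) (B : Site P (j + 1)) (v : B7Prop1Explicit.Site P.d)
    (hv : ∀ ν, (v ν).natAbs ≤ (P.L - 1) / 2) : blockOf (transl (emb B) v) = B := by
  refine blockOf_eq_of_near_emb hj B (transl (emb B) v) v (fun ν => transl_apply _ _ _) (fun ν => ?_)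
  have h := hv ν
  rcases Int.natAbs_eq (v ν) with hh | hh <;> constructor <;> omega

/-- The relative position of such a translate from the centre IS the vector. [cite: Balaban1985UV3, (27) p.263 (bookkeeping)] -/
theorem rel_emb_transl (hj : j + 1 ≤ P.m + P.K) (B : Site P (j + 1)) (v : B7Prop1Explicit.Site P.d)
    (hv : ∀ ν, (v ν).natAbs ≤ (P.L - 1) / 2) : rel (emb B) (transl (emb B) v) = v := by
  refine rel_transl_of_mem (emb B) v (fun ν => ?_)
  have h := hv ν
  have hN : 2 * P.L ≤ P.sitesPerDir j := AveragingReflection.two_mul_L_le_sitesPerDir hj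
  have hL := AveragingRT.two_mul_half_add_one P
  have hN' : (2 * P.L : ℤ) ≤ (P.sitesPerDir j : ℤ) := by exact_mod_cast hN
  have hL' : (2 * ((P.L - 1) / 2 : ℕ) + 1 : ℤ) = (P.L : ℤ) := by exact_mod_cast hL
  rcases Int.natAbs_eq (v ν) with hh | hh <;> constructor <;> push_cast at * <;> omega

/-- Coordinates of `v − e_μ`. [folklore] -/
theorem coord_sub_e (v : B7Prop1Explicit.Site P.d) (μ ν : Fin P.d) : (v - e μ) ν = v ν - if ν = μ then 1 else 0 := by
  rw [Pi.sub_apply, e_apply]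

/-- Coordinates of `v + e_μ`. [folklore] -/
theorem coord_add_e (v : B7Prop1Explicit.Site P.d) (μ ν : Fin P.d) : (v + e μ) ν = v ν + if ν = μ then 1 else 0 := by
  rw [Pi.add_apply, e_apply]

/-- The LOWEST direction below `e` carrying a nonzero coordinate. [folklore] -/
theorem exists_min_dir (v : B7Prop1Explicit.Site P.d) (e : Fin P.d) (h : ∃ μ, μ < e ∧ v μ ≠ 0) :
    ∃ μ, μ < e ∧ v μ ≠ 0 ∧ ∀ ν, ν < μ → v ν = 0 := by
  classical
  set s : Finset (Fin P.d) := Finset.univ.filter (fun ν => ν < e ∧ v ν ≠ 0) with hs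
  have hne : s.Nonempty := by
    obtain ⟨μ, hμ, hv⟩ := h
    exact ⟨μ, by simp only [hs, Finset.mem_filter, Finset.mem_univ, true_and]; exact ⟨hμ, hv⟩⟩
  have hmem := Finset.min'_mem s hne
  simp only [hs, Finset.mem_filter, Finset.mem_univ, true_and] at hmem
  refine ⟨s.min' hne, hmem.1, hmem.2, fun ν hν => ?_⟩
  by_contra hvν
  have hνs : ν ∈ s := by
    simp only [hs, Finset.mem_filter, Finset.mem_univ, true_and]
    exact ⟨lt_trans hν hmem.1, hvν⟩
  exact absurd (Finset.min'_le s ν hνs) (not_le.mpr hν)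

/-! ## §2 The coordinate form: induction on `Σ_{ν<e} |v_ν|` -/

/-- ★★★ **THE INTRA-BLOCK TOP LADDER, COORDINATE FORM.**  `W = U` on the tree-comb bonds of `B` and relative plaquettes `≤ ρ` on `B` ⟹ for every `v` with `|v|_∞ ≤ (L−1)∕2`,
`v_e + 1 ≤ (L−1)∕2` and `Σ_{ν<e} |v_ν| = n`: `dist1 (U⟨emb B + v, e⟩⁻¹·W⟨emb B + v, e⟩) ≤ n·ρ`.
[cite: Balaban1989LargeFieldII, p.382; Balaban1985Averaging, (19) p.21, p.24] -/
theorem dist1_chord_transl_le (hj : j + 1 ≤ P.m + P.K) (W U : GaugeField P j G) (B : Site P (j + 1))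
    (htree : ∀ (x : Site P j) (μ : Fin P.d), blockOf x = B → blockOf (x.shift μ) = B → (∀ ν, ν < μ → rel (emb B) x ν = 0) → W ⟨x, μ⟩ = U ⟨x, μ⟩)
    {ρ : ℝ} (hρ0 : 0 ≤ ρ) (hρ : ∀ q : Plaq P j, blockOf q.src = B → dist1 ((GaugeField.plaqHol U q)⁻¹ * GaugeField.plaqHol W q) ≤ ρ)
    (e' : Fin P.d) :
    ∀ (n : ℕ) (v : B7Prop1Explicit.Site P.d), (∀ ν, (v ν).natAbs ≤ (P.L - 1) / 2) → v e' + 1 ≤ (((P.L - 1) / 2 : ℕ) : ℤ) →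
      (∑ ν ∈ Finset.univ.filter (fun ν => ν < e'), (v ν).natAbs) = n →
        dist1 ((U ⟨transl (emb B) v, e'⟩)⁻¹ * W ⟨transl (emb B) v, e'⟩) ≤ n * ρ := by
  -- bookkeeping used in both cases
  have hin : ∀ v : B7Prop1Explicit.Site P.d, (∀ ν, (v ν).natAbs ≤ (P.L - 1) / 2) → blockOf (transl (emb B) v) = B :=
    fun v hv => blockOf_transl_emb hj B v hv
  have hshift : ∀ (v : B7Prop1Explicit.Site P.d) (μ : Fin P.d), (transl (emb B) v).shift μ = transl (emb B) (v + e μ) :=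
    fun v μ => (transl_add_e (emb B) v μ).symm
  -- `+ e_e` keeps the sup bound when `v_e + 1 ≤ h`
  have hve : ∀ v : B7Prop1Explicit.Site P.d, (∀ ν, (v ν).natAbs ≤ (P.L - 1) / 2) → v e' + 1 ≤ (((P.L - 1) / 2 : ℕ) : ℤ) →
      ∀ ν, ((v + e e') ν).natAbs ≤ (P.L - 1) / 2 := by
    intro v hv hve ν
    rw [coord_add_e]
    have h := hv ν
    by_cases hν : ν = e'
    · subst hν; rw [if_pos rfl]
      rcases Int.natAbs_eq (v ν) with hh | hh <;> rcases Int.natAbs_eq (v ν + 1) with hh' | hh' <;> omega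
    · rw [if_neg hν, add_zero]; exact h
  intro n
  induction n with
  | zero =>
    intro v hv hve' hsum
    -- every lower coordinate vanishes: `⟨y, e⟩` is a tree-comb bond
    have hlo : ∀ ν, ν < e' → rel (emb B) (transl (emb B) v) ν = 0 := by
      intro ν hν
      rw [rel_emb_transl hj B v hv]
      have h0 : (v ν).natAbs = 0 := by
        have := Finset.sum_eq_zero_iff.mp hsum ν (by simp only [Finset.mem_filter, Finset.mem_univ, true_and]; exact hν)
        exact this
      exact Int.natAbs_eq_zero.mp h0
    have hW : W ⟨transl (emb B) v, e'⟩ = U ⟨transl (emb B) v, e'⟩ :=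
      htree _ _ (hin v hv) (by rw [hshift]; exact hin _ (hve v hv hve')) hlo
    rw [hW, inv_mul_cancel, GaugeGroup.dist1_one, Nat.cast_zero, zero_mul]
  | succ n ih =>
    intro v hv hve' hsum
    -- a nonzero lower coordinate exists; take the lowest
    have hex : ∃ μ, μ < e' ∧ v μ ≠ 0 := by
      by_contra hnone
      have hzero : ∀ ν, ν < e' → v ν = 0 := fun ν hν => by
        by_contra h
        exact hnone ⟨ν, hν, h⟩
      have : (∑ ν ∈ Finset.univ.filter (fun ν => ν < e'), (v ν).natAbs) = 0 :=
        Finset.sum_eq_zero (fun ν hν => by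
          simp only [Finset.mem_filter, Finset.mem_univ, true_and] at hν
          rw [hzero ν hν, Int.natAbs_zero])
      omega
    obtain ⟨μ, hμe, hvμ, hlo⟩ := exists_min_dir v e' hex
    have hμne : μ ≠ e' := ne_of_lt hμe
    have heμ : e' ≠ μ := fun h => hμne h.symm
    set y := transl (emb B) v with hy
    have hyB : blockOf y = B := hin v hv
    have hyeB : blockOf (y.shift e') = B := by rw [hshift]; exact hin _ (hve v hv hve')
    rcases lt_or_gt_of_ne hvμ with hneg | hpos
    · -- NEGATIVE coordinate: `y' = y + e_μ`, the square at `y` read backwards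
      set v' := v + e μ with hv'
      have hv'b : ∀ ν, (v' ν).natAbs ≤ (P.L - 1) / 2 := by
        intro ν; rw [hv', coord_add_e]
        have h := hv ν
        by_cases hν : ν = μ
        · subst hν; rw [if_pos rfl]
          have hμ := hv ν
          rcases Int.natAbs_eq (v ν) with hh | hh <;> rcases Int.natAbs_eq (v ν + 1) with hh' | hh' <;> omega
        · rw [if_neg hν, add_zero]; exact h
      have hv'e : v' e' + 1 ≤ (((P.L - 1) / 2 : ℕ) : ℤ) := by rw [hv', coord_add_e, if_neg heμ, add_zero]; exact hve'
      have hv'sum : (∑ ν ∈ Finset.univ.filter (fun ν => ν < e'), (v' ν).natAbs) = n := by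
        have hμmem : μ ∈ Finset.univ.filter (fun ν => ν < e') := by
          simp only [Finset.mem_filter, Finset.mem_univ, true_and]; exact hμe
        have hsplit := Finset.add_sum_erase _ (fun ν => (v ν).natAbs) hμmem
        have hsplit' := Finset.add_sum_erase _ (fun ν => (v' ν).natAbs) hμmem
        have hrest : (∑ ν ∈ (Finset.univ.filter (fun ν => ν < e')).erase μ, (v' ν).natAbs) =
            ∑ ν ∈ (Finset.univ.filter (fun ν => ν < e')).erase μ, (v ν).natAbs :=
          Finset.sum_congr rfl (fun ν hν => by
            rw [hv', coord_add_e, if_neg (Finset.ne_of_mem_erase hν), add_zero])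
        have hμ' : (v' μ).natAbs + 1 = (v μ).natAbs := by
          rw [hv', coord_add_e, if_pos rfl]
          rcases Int.natAbs_eq (v μ) with hh | hh <;> rcases Int.natAbs_eq (v μ + 1) with hh' | hh' <;> omega
        omega
      have hIH := ih v' hv'b hv'e hv'sum
      -- the far rung `⟨y + e_μ, e⟩` is `⟨transl v', e⟩`
      have hfar : y.shift μ = transl (emb B) v' := by rw [hy, hshift]
      -- rails are tree-comb
      have hbot : W ⟨y, μ⟩ = U ⟨y, μ⟩ := by
        refine htree y μ hyB (by rw [hfar]; exact hin v' hv'b) (fun ν hν => ?_)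
        rw [hy, rel_emb_transl hj B v hv]; exact hlo ν hν
      have htop : W ⟨y.shift e', μ⟩ = U ⟨y.shift e', μ⟩ := by
        refine htree (y.shift e') μ hyeB ?_ (fun ν hν => ?_)
        · rw [hy, hshift, hshift]
          have : v + e e' + e μ = v' + e e' := by rw [hv']; abel
          rw [this]; exact hin _ (hve v' hv'b hv'e)
        · rw [hy, hshift, rel_emb_transl hj B _ (hve v hv hve'), coord_add_e, if_neg (ne_of_lt (lt_trans hν hμe)), add_zero]
          exact hlo ν hν
      -- the backward step
      have hstep := dist1_nearRung_rel_le W U y μ e'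
      have hsq := dist1_square_rel_le W U hρ0 y (fun q hq => hρ q (by rw [hq]; exact hyB)) μ e'
      rw [dist1_mul_inv_eq_rel] at hsq
      have hrail : dist1 ((W ⟨y.shift e', μ⟩)⁻¹ * U ⟨y.shift e', μ⟩ *
          ((U ⟨y.shift μ, e'⟩)⁻¹ * ((U ⟨y, μ⟩)⁻¹ * W ⟨y, μ⟩) * U ⟨y.shift μ, e'⟩)) = 0 := by
        rw [htop, hbot, inv_mul_cancel, inv_mul_cancel, mul_one, inv_mul_cancel, mul_one, GaugeGroup.dist1_one]
      rw [hfar] at hstep hrail hsq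
      rw [hrail, add_zero] at hstep
      calc dist1 ((U ⟨y, e'⟩)⁻¹ * W ⟨y, e'⟩)
          ≤ _ := hstep
        _ ≤ ρ + n * ρ := add_le_add hsq hIH
        _ = ((n + 1 : ℕ) : ℝ) * ρ := by push_cast; ring
    · -- POSITIVE coordinate: `y' = y − e_μ`, the square at `y'` read forwards
      set v' := v - e μ with hv'
      have hv'b : ∀ ν, (v' ν).natAbs ≤ (P.L - 1) / 2 := by
        intro ν; rw [hv', coord_sub_e]
        have h := hv ν
        by_cases hν : ν = μ
        · subst hν; rw [if_pos rfl]
          rcases Int.natAbs_eq (v ν) with hh | hh <;> rcases Int.natAbs_eq (v ν - 1) with hh' | hh' <;> omega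
        · rw [if_neg hν, sub_zero]; exact h
      have hv'e : v' e' + 1 ≤ (((P.L - 1) / 2 : ℕ) : ℤ) := by rw [hv', coord_sub_e, if_neg heμ, sub_zero]; exact hve'
      have hv'sum : (∑ ν ∈ Finset.univ.filter (fun ν => ν < e'), (v' ν).natAbs) = n := by
        have hμmem : μ ∈ Finset.univ.filter (fun ν => ν < e') := by
          simp only [Finset.mem_filter, Finset.mem_univ, true_and]; exact hμe
        have hsplit := Finset.add_sum_erase _ (fun ν => (v ν).natAbs) hμmem
        have hsplit' := Finset.add_sum_erase _ (fun ν => (v' ν).natAbs) hμmem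
        have hrest : (∑ ν ∈ (Finset.univ.filter (fun ν => ν < e')).erase μ, (v' ν).natAbs) =
            ∑ ν ∈ (Finset.univ.filter (fun ν => ν < e')).erase μ, (v ν).natAbs :=
          Finset.sum_congr rfl (fun ν hν => by
            rw [hv', coord_sub_e, if_neg (Finset.ne_of_mem_erase hν), sub_zero])
        have hμ' : (v' μ).natAbs + 1 = (v μ).natAbs := by
          rw [hv', coord_sub_e, if_pos rfl]
          rcases Int.natAbs_eq (v μ) with hh | hh <;> rcases Int.natAbs_eq (v μ - 1) with hh' | hh' <;> omega
        omega
      have hIH := ih v' hv'b hv'e hv'sum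
      set y' := transl (emb B) v' with hy'
      have hy'B : blockOf y' = B := hin v' hv'b
      -- the far rung of the square at `y'` is `⟨y, e⟩`
      have hfar : y'.shift μ = y := by
        rw [hy', hshift, hy]
        have : v' + e μ = v := by rw [hv']; abel
        rw [this]
      have hbot : W ⟨y', μ⟩ = U ⟨y', μ⟩ := by
        refine htree y' μ hy'B (by rw [hfar]; exact hyB) (fun ν hν => ?_)
        rw [hy', rel_emb_transl hj B v' hv'b, hv', coord_sub_e, if_neg (ne_of_lt hν), sub_zero]; exact hlo ν hν
      have htop : W ⟨y'.shift e', μ⟩ = U ⟨y'.shift e', μ⟩ := by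
        refine htree (y'.shift e') μ (by rw [hy', hshift]; exact hin _ (hve v' hv'b hv'e)) ?_ (fun ν hν => ?_)
        · rw [hy', hshift, hshift]
          have : v' + e e' + e μ = v + e e' := by rw [hv']; abel
          rw [this]; exact hin _ (hve v hv hve')
        · rw [hy', hshift, rel_emb_transl hj B _ (hve v' hv'b hv'e), coord_add_e, if_neg (ne_of_lt (lt_trans hν hμe)), add_zero,
            hv', coord_sub_e, if_neg (ne_of_lt hν), sub_zero]
          exact hlo ν hν
      have hstep := dist1_farRung_rel_le W U y' μ e'
      have hsq := dist1_square_rel_le W U hρ0 y' (fun q hq => hρ q (by rw [hq]; exact hy'B)) μ e'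
      rw [dist1_mul_inv_eq_rel] at hsq
      have hrail : dist1 (W ⟨y'.shift e', μ⟩ * (U ⟨y'.shift e', μ⟩)⁻¹ *
          ((U ⟨y', μ⟩ * U ⟨y'.shift μ, e'⟩ * (U ⟨y'.shift e', μ⟩)⁻¹ * (U ⟨y', e'⟩)⁻¹ * U ⟨y', e'⟩)⁻¹ * (U ⟨y', μ⟩ * (W ⟨y', μ⟩)⁻¹) *
            (U ⟨y', μ⟩ * U ⟨y'.shift μ, e'⟩ * (U ⟨y'.shift e', μ⟩)⁻¹ * (U ⟨y', e'⟩)⁻¹ * U ⟨y', e'⟩))) = 0 := by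
        rw [htop, hbot, mul_inv_cancel, mul_inv_cancel, one_mul, mul_one, inv_mul_cancel, GaugeGroup.dist1_one]
      rw [hrail, add_zero, hfar] at hstep
      rw [hfar] at hsq
      calc dist1 ((U ⟨y, e'⟩)⁻¹ * W ⟨y, e'⟩)
          ≤ _ := hstep
        _ ≤ ρ + n * ρ := add_le_add hsq hIH
        _ = ((n + 1 : ℕ) : ℝ) * ρ := by push_cast; ring

/-! ## §3 The block form -/

/-- ★★★ **THE INTRA-BLOCK TOP LADDER.**  If `W = U` on every tree-comb bond of the block `B` and every plaquette with source in `B` has relative size `≤ ρ`, then every bond `⟨y, e⟩` with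
`y, y + e ∈ B` obeys `dist1 (U⟨y,e⟩⁻¹·W⟨y,e⟩) ≤ (Σ_{ν<e} |(y − emb B)_ν|)·ρ`. [cite: Balaban1989LargeFieldII, p.382; Balaban1985Averaging, (19) p.21, p.24] -/
theorem dist1_chord_le_of_intraBlock (hj : j + 1 ≤ P.m + P.K) (W U : GaugeField P j G) (B : Site P (j + 1))
    (htree : ∀ (x : Site P j) (μ : Fin P.d), blockOf x = B → blockOf (x.shift μ) = B → (∀ ν, ν < μ → rel (emb B) x ν = 0) → W ⟨x, μ⟩ = U ⟨x, μ⟩)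
    {ρ : ℝ} (hρ0 : 0 ≤ ρ) (hρ : ∀ q : Plaq P j, blockOf q.src = B → dist1 ((GaugeField.plaqHol U q)⁻¹ * GaugeField.plaqHol W q) ≤ ρ)
    (y : Site P j) (e' : Fin P.d) (hy : blockOf y = B) (hye : blockOf (y.shift e') = B) :
    dist1 ((U ⟨y, e'⟩)⁻¹ * W ⟨y, e'⟩) ≤ (∑ ν ∈ Finset.univ.filter (fun ν => ν < e'), (rel (emb B) y ν).natAbs) * ρ := by
  set v := rel (emb B) y with hv
  have hyv : y = transl (emb B) v := by rw [hv, transl_rel]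
  have hvb : ∀ ν, (v ν).natAbs ≤ (P.L - 1) / 2 :=
    fun ν => FluctuationComparisonRegPrIntLS2BetaIterAxialGaugeOneLevel.natAbs_rel_emb_le hj hy ν
  have hve : v e' + 1 ≤ (((P.L - 1) / 2 : ℕ) : ℤ) := by
    -- no wrap: `rel (y + e) = v + e_e`, and `y + e ∈ B` bounds its `e`-coordinate
    have hwrap : (rel (emb B) y e' + 1) * 2 ≤ (P.sitesPerDir j : ℤ) := FluctuationComparisonRegPrIntLS2BetaIterAxialGaugeOneLevel.noWrap_emb hj hy e'
    have hsh : rel (emb B) (y.shift e') = v + e e' := by rw [hv]; exact rel_shift_of_le (emb B) y e' hwrap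
    have h := FluctuationComparisonRegPrIntLS2BetaIterAxialGaugeOneLevel.natAbs_rel_emb_le hj hye e'
    rw [hsh, coord_add_e, if_pos rfl] at h
    rcases Int.natAbs_eq (v e' + 1) with hh | hh <;> omega
  have hmain := dist1_chord_transl_le hj W U B htree hρ0 hρ e' _ v hvb hve rfl
  rw [← hyv] at hmain
  exact_mod_cast hmain

/-- ★ The crude form: `dist1 (U⟨y,e⟩⁻¹·W⟨y,e⟩) ≤ (e·((L−1)∕2))·ρ` (each of the `e` lower coordinates is at most `(L−1)∕2` in absolute value).
[cite: Balaban1989LargeFieldII, p.382; Balaban1987RG1, (0.3) p.252] -/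
theorem dist1_chord_le_of_intraBlock' (hj : j + 1 ≤ P.m + P.K) (W U : GaugeField P j G) (B : Site P (j + 1))
    (htree : ∀ (x : Site P j) (μ : Fin P.d), blockOf x = B → blockOf (x.shift μ) = B → (∀ ν, ν < μ → rel (emb B) x ν = 0) → W ⟨x, μ⟩ = U ⟨x, μ⟩)
    {ρ : ℝ} (hρ0 : 0 ≤ ρ) (hρ : ∀ q : Plaq P j, blockOf q.src = B → dist1 ((GaugeField.plaqHol U q)⁻¹ * GaugeField.plaqHol W q) ≤ ρ)
    (y : Site P j) (e' : Fin P.d) (hy : blockOf y = B) (hye : blockOf (y.shift e') = B) :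
    dist1 ((U ⟨y, e'⟩)⁻¹ * W ⟨y, e'⟩) ≤ ((e'.val * ((P.L - 1) / 2) : ℕ) : ℝ) * ρ := by
  have h := dist1_chord_le_of_intraBlock hj W U B htree hρ0 hρ y e' hy hye
  refine h.trans (mul_le_mul_of_nonneg_right ?_ hρ0)
  have hcount : (Finset.univ.filter (fun ν : Fin P.d => ν < e')).card = e'.val := by
    rw [show (Finset.univ.filter (fun ν : Fin P.d => ν < e')) = Finset.Iio e' by ext ν; simp, Fin.card_Iio]
  have hb : (∑ ν ∈ Finset.univ.filter (fun ν => ν < e'), (rel (emb B) y ν).natAbs) ≤ e'.val * ((P.L - 1) / 2) := by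
    calc (∑ ν ∈ Finset.univ.filter (fun ν => ν < e'), (rel (emb B) y ν).natAbs)
        ≤ ∑ _ν ∈ Finset.univ.filter (fun ν => ν < e'), (P.L - 1) / 2 :=
          Finset.sum_le_sum (fun ν _ => FluctuationComparisonRegPrIntLS2BetaIterAxialGaugeOneLevel.natAbs_rel_emb_le hj hy ν)
      _ = e'.val * ((P.L - 1) / 2) := by rw [Finset.sum_const, hcount, smul_eq_mul]
  exact_mod_cast hb

end Summit.QuantumFields.YangMills.Theorems.FluctuationComparisonRegPrIntLS2BetaTopLadderIntraBlock
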